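import Summits.KontsevichZagierPeriods.KontsevichZagierPeriods.Theorems.LinRedNormalFormArrangementNormalFormSeparateAllHHLocal
import Summits.KontsevichZagierPeriods.KontsevichZagierPeriods.Theorems.LinRedNormalFormArrangementNormalFormSeparateThreeHHKFM
import Summits.KontsevichZagierPeriods.KontsevichZagierPeriods.Theorems.LinRedNormalFormArrangementNormalFormSeparateTwoMeas
import Summits.KontsevichZagierPeriods.KontsevichZagierPeriods.Theorems.LinRedNormalFormArrangementNormalFormSeparateTwoZeroWeights

/-!
# Termwise absolute convergence of the Taylor split in every base dimension (`stub_separateHigh_hH`)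

(Line `janus-bands`, crux `ArrangementNormalForm`, stub `stub_separateHigh_hH`, part `AllHHFinal`:
the wall-invariant termwise-split lemma in base dimension `b + 1 ≥ 4` with fibres, proved by the
dimension-generic nested-sector method of the parts `AllHH*`, namespace `SepAll`.)
Base dimension `b + 1` (base `(x′, y)`, `x′ ∈ ℝ^b`), `k` fibres. A terminal piece of the far-first
separation engine carries `P(x)/∏ L_j(x′)^{e_j} · (y − ℓ(x′))^{-n} · (fibre block)` on a bounded
`polyhedron × fibre cell`, absolutely convergent, with the wall invariant `hH` (an active
`x′`-letter vanishes on the closed domain only on the pole hyperplane, and then `n ≠ 0`). CLAIM: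
every Taylor piece `q_i(x′) (y − ℓ)^{i−n}/∏ L_j^{e_j} · (fibre block)` is absolutely integrable on
the domain. Proof: the Tonelli dictionary (parts `Mass`, `Meas` of the planar case) reduces both the
hypothesis and the claim to base integrals against the fibre mass `lmass` over the EFFECTIVE base
polyhedron (Fourier–Motzkin, part `HHKFM`), on whose closure the wall invariant is available; the
claim is local on the compact closure, and the local theorem `SepAll.local_finite` of part
`AllHHLocal` applies. Degenerate letters and an identically vanishing numerator make every piece
vanish identically (`eval_eq_zero_of_num_zero`: the pole coordinate is transcendental over the
functions of `x′`). The hypothesis `b = B + 1 + 2` is not used by the method.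
-/

noncomputable section

open Set MeasureTheory Filter Topology
open scoped ENNReal

namespace Summit.KontsevichZagierPeriods.ArrangementNormalForm.JanusBands

open Literature.NumberTheory.Transcendental

namespace SepAll

open SepTwo Literature.ModelTheory.ExponentialFields Finset MvPolynomial

variable {b : ℕ}

/-! ### Reading the literal base factors -/

/-- Rational coefficient polynomials evaluated at the `x′`-part. -/
theorem aeval_eq_eval_pr (qi : MvPolynomial (Fin b) ℚ) (x : Fin (b + 1) → ℝ) :
    MvPolynomial.aeval (fun i => x (Fin.castSucc i)) qi =
      MvPolynomial.eval (pr x) (MvPolynomial.map (algebraMap ℚ ℝ) qi) := by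
  rw [MvPolynomial.eval_map, MvPolynomial.aeval_def]; rfl

/-- The literal base factor of the integrand in nice form. -/
theorem baseR_eq {m : ℕ} (L : Fin m → (Fin b → ℚ) × ℚ) (e : Fin m → ℕ)
    (p : MvPolynomial (Fin (b + 1)) ℚ) (ℓ : (Fin b → ℚ) × ℚ) (n N : ℕ)
    (q : ℕ → MvPolynomial (Fin b) ℚ)
    (hq : ∀ x : Fin (b + 1) → ℝ, MvPolynomial.aeval x p = ∑ i ∈ Finset.range N,
      MvPolynomial.aeval (fun i => x (Fin.castSucc i)) (q i) *
        (x (Fin.last b) - (∑ i, (ℓ.1 i : ℝ) * x (Fin.castSucc i) + (ℓ.2 : ℝ))) ^ i)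
    (x : Fin (b + 1) → ℝ) :
    MvPolynomial.aeval x p / (∏ j, (∑ i, ((L j).1 i : ℝ) * x (Fin.castSucc i) + ((L j).2 : ℝ)) ^ e j) *
        (1 / (x (Fin.last b) - (∑ i, (ℓ.1 i : ℝ) * x (Fin.castSucc i) + (ℓ.2 : ℝ))) ^ n) =
      (∑ i ∈ Finset.range N, MvPolynomial.eval (pr x) (MvPolynomial.map (algebraMap ℚ ℝ) (q i)) *
        lam (fun i => (ℓ.1 i : ℝ)) ℓ.2 x ^ i) /
        common (fun j i => ((L j).1 i : ℝ)) (fun j => ((L j).2 : ℝ)) e n (fun i => (ℓ.1 i : ℝ)) ℓ.2 x := by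
  rw [hq x]
  simp only [aeval_eq_eval_pr, one_div]
  rw [← div_eq_mul_inv, div_div]
  rfl

/-- The literal base factor of a Taylor piece in nice form. -/
theorem baseRi_eq {m : ℕ} (L : Fin m → (Fin b → ℚ) × ℚ) (e : Fin m → ℕ) (ℓ : (Fin b → ℚ) × ℚ)
    (n : ℕ) (qi : MvPolynomial (Fin b) ℚ) (i : ℕ) (x : Fin (b + 1) → ℝ) :
    MvPolynomial.aeval (fun i => x (Fin.castSucc i)) qi /
        (∏ j, (∑ i, ((L j).1 i : ℝ) * x (Fin.castSucc i) + ((L j).2 : ℝ)) ^ e j) *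
        ((x (Fin.last b) - (∑ i, (ℓ.1 i : ℝ) * x (Fin.castSucc i) + (ℓ.2 : ℝ))) ^ i /
          (x (Fin.last b) - (∑ i, (ℓ.1 i : ℝ) * x (Fin.castSucc i) + (ℓ.2 : ℝ))) ^ n) =
      MvPolynomial.eval (pr x) (MvPolynomial.map (algebraMap ℚ ℝ) qi) *
          lam (fun i => (ℓ.1 i : ℝ)) ℓ.2 x ^ i /
        common (fun j i => ((L j).1 i : ℝ)) (fun j => ((L j).2 : ℝ)) e n (fun i => (ℓ.1 i : ℝ)) ℓ.2 x := by
  simp only [aeval_eq_eval_pr]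
  rw [div_mul_div_comm]
  rfl

/-- `x′`-forms are measurable on the base. -/
theorem measurable_xform (c : (Fin b → ℚ) × ℚ) :
    Measurable fun x : Fin (b + 1) → ℝ => ∑ i, (c.1 i : ℝ) * x (Fin.castSucc i) + (c.2 : ℝ) := by
  refine Measurable.add_const (Finset.measurable_sum _ fun i _ => ?_) _
  exact (measurable_pi_apply _).const_mul _

/-- The literal base factor of the integrand is measurable. -/
theorem measurable_baseR {m : ℕ} (L : Fin m → (Fin b → ℚ) × ℚ) (e : Fin m → ℕ)
    (p : MvPolynomial (Fin (b + 1)) ℚ) (ℓ : (Fin b → ℚ) × ℚ) (n : ℕ) :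
    Measurable fun x : Fin (b + 1) → ℝ => MvPolynomial.aeval x p /
      (∏ j, (∑ i, ((L j).1 i : ℝ) * x (Fin.castSucc i) + ((L j).2 : ℝ)) ^ e j) *
      (1 / (x (Fin.last b) - (∑ i, (ℓ.1 i : ℝ) * x (Fin.castSucc i) + (ℓ.2 : ℝ))) ^ n) := by
  refine ((measurable_aeval_real p).div ?_).mul ?_
  · exact Finset.measurable_prod _ fun j _ => (measurable_xform (L j)).pow_const _
  · exact Measurable.const_div (((measurable_pi_apply _).sub (measurable_xform ℓ)).pow_const _) _

/-- The literal base factor of a Taylor piece is measurable. -/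
theorem measurable_baseRi {m : ℕ} (L : Fin m → (Fin b → ℚ) × ℚ) (e : Fin m → ℕ)
    (ℓ : (Fin b → ℚ) × ℚ) (n : ℕ) (qi : MvPolynomial (Fin b) ℚ) (i : ℕ) :
    Measurable fun x : Fin (b + 1) → ℝ => MvPolynomial.aeval (fun i => x (Fin.castSucc i)) qi /
      (∏ j, (∑ i, ((L j).1 i : ℝ) * x (Fin.castSucc i) + ((L j).2 : ℝ)) ^ e j) *
      ((x (Fin.last b) - (∑ i, (ℓ.1 i : ℝ) * x (Fin.castSucc i) + (ℓ.2 : ℝ))) ^ i /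
        (x (Fin.last b) - (∑ i, (ℓ.1 i : ℝ) * x (Fin.castSucc i) + (ℓ.2 : ℝ))) ^ n) := by
  have hlam : Measurable fun x : Fin (b + 1) → ℝ =>
      x (Fin.last b) - (∑ i, (ℓ.1 i : ℝ) * x (Fin.castSucc i) + (ℓ.2 : ℝ)) :=
    (measurable_pi_apply _).sub (measurable_xform ℓ)
  refine (Measurable.div ?_ ?_).mul ((hlam.pow_const _).div (hlam.pow_const _))
  · exact (measurable_aeval_real qi).comp (measurable_pi_lambda _ fun i => measurable_pi_apply _)
  · exact Finset.measurable_prod _ fun j _ => (measurable_xform (L j)).pow_const _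

/-- **An identically vanishing numerator has vanishing coefficient polynomials**: the pole
coordinate is transcendental over the functions of `x′`. -/
theorem eval_eq_zero_of_num_zero (N : ℕ) (q : ℕ → MvPolynomial (Fin b) ℝ) (l : Fin b → ℝ) (l₀ : ℝ)
    (h : ∀ x : Fin (b + 1) → ℝ, (∑ i ∈ Finset.range N, MvPolynomial.eval (pr x) (q i) *
      lam l l₀ x ^ i) = 0) (i : ℕ) (hi : i < N) (w : Fin b → ℝ) :
    MvPolynomial.eval w (q i) = 0 := by
  classical
  set P : Polynomial ℝ := ∑ j ∈ Finset.range N,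
    Polynomial.C (MvPolynomial.eval w (q j)) * Polynomial.X ^ j with hP
  have hpr : ∀ t : ℝ, pr (Fin.snoc w t : Fin (b + 1) → ℝ) = w := fun t => by
    funext j; simp [pr, Fin.snoc_castSucc]
  have hlam : ∀ t : ℝ, lam l l₀ (Fin.snoc w (t + (∑ j, l j * w j + l₀)) : Fin (b + 1) → ℝ) = t := by
    intro t
    simp only [lam, Fin.snoc_last, Fin.snoc_castSucc]
    ring
  have heval : ∀ t : ℝ, P.eval t = 0 := by
    intro t
    have hx := h (Fin.snoc w (t + (∑ j, l j * w j + l₀)))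
    rw [hpr, hlam] at hx
    rw [hP, Polynomial.eval_finsetSum]
    simp only [Polynomial.eval_mul, Polynomial.eval_C, Polynomial.eval_pow, Polynomial.eval_X]
    exact hx
  have hP0 : P = 0 := Polynomial.funext fun t => by rw [heval, Polynomial.eval_zero]
  have hc := congrArg (fun Q : Polynomial ℝ => Q.coeff i) hP0
  simp only [hP, Polynomial.finsetSum_coeff, Polynomial.coeff_C_mul_X_pow, Polynomial.coeff_zero] at hc
  rw [Finset.sum_ite_eq (Finset.range N) i, if_pos (Finset.mem_range.2 hi)] at hc
  exact hc

end SepAll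

/-! ### The stub -/

open SepTwo SepAll in
/-- **Termwise absolute convergence of the Taylor split under the wall invariant, every base
dimension `≥ 4`** (`stub_separateHigh_hH`, registered stub of the line `janus-bands`): see the
module docstring. -/
theorem stub_separateHigh_hH (B : ℕ) (b k m m' n : ℕ) (s : KZ.IntegralRep (b + 1 + k)) (M : Fin m' → (Fin (b + 1) → ℚ) × ℚ) (L : Fin m → (Fin b → ℚ) × ℚ) (e : Fin m → ℕ) (p : MvPolynomial (Fin (b + 1)) ℚ) (ℓ : (Fin b → ℚ) × ℚ) (a : Fin k → Option ((Fin (b + 1) → ℚ) × ℚ)) (lo hi : Fin k → Fin k ⊕ ((Fin (b + 1) → ℚ) × ℚ)) (hpole : n ≠ 0 → ∀ z ∈ s.domain, (z (Fin.castAdd k (Fin.last b)) - (∑ i, (ℓ.1 i : ℝ) * z (Fin.castAdd k (Fin.castSucc i)) + (ℓ.2 : ℝ))) ≠ 0) (hbd : Bornology.IsBounded s.domain) (hdom : s.domain = {z | (∀ j, 0 < ∑ i, ((M j).1 i : ℝ) * z (Fin.castAdd k i) + ((M j).2 : ℝ)) ∧ ∀ i, Sum.elim (fun j => z (Fin.natAdd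 (b + 1) j)) (fun c => ∑ i', (c.1 i' : ℝ) * z (Fin.castAdd k i') + (c.2 : ℝ)) (lo i) < z (Fin.natAdd (b + 1) i) ∧ z (Fin.natAdd (b + 1) i) < Sum.elim (fun j => z (Fin.natAdd (b + 1) j)) (fun c => ∑ i', (c.1 i' : ℝ) * z (Fin.castAdd k i') + (c.2 : ℝ)) (hi i)}) (hint : EqOn s.integrand (fun z => MvPolynomial.aeval (fun i => z (Fin.castAdd k i)) p / (∏ j, (∑ i, ((L j).1 i : ℝ) * z (Fin.castAdd k (Fin.castSucc i)) + ((L j).2 : ℝ)) ^ e j) * (1 / (z (Fin.castAdd k (Fin.last b)) - (∑ i, (ℓ.1 i : ℝ) * z (Fin.castAdd k (Fin.castSucc i)) + (ℓ.2 : ℝ))) ^ n) * ∏ i, (a i).elim 1 (fun c => 1 / (z (Fin.natAdd (b + 1) i) - (∑ i', (c.1 i' : ℝ) * z (Fin.castAdd k i') + (c.2 : ℝ))))) s.domain) (N : ℕ) (q : ℕ → MvPolynomial (Fin b) ℚ) (hq : ∀ z : Fin (b + 1 + k) → ℝ, MvPolynomial.aeval (fun i => z (Fin.castAdd k i)) p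 = ∑ i ∈ Finset.range N, MvPolynomial.aeval (fun i => z (Fin.castAdd k (Fin.castSucc i))) (q i) * (z (Fin.castAdd k (Fin.last b)) - (∑ i, (ℓ.1 i : ℝ) * z (Fin.castAdd k (Fin.castSucc i)) + (ℓ.2 : ℝ))) ^ i) (hb : b = B + 1 + 2) (hH : ∀ j, e j ≠ 0 → ∀ z ∈ closure s.domain, (∑ i, ((L j).1 i : ℝ) * z (Fin.castAdd k (Fin.castSucc i)) + ((L j).2 : ℝ)) = 0 → (n ≠ 0 ∧ z (Fin.castAdd k (Fin.last b)) = ∑ i, (ℓ.1 i : ℝ) * z (Fin.castAdd k (Fin.castSucc i)) + (ℓ.2 : ℝ))) : ∀ i ∈ Finset.range N, IntegrableOn (fun z => MvPolynomial.aeval (fun i => z (Fin.castAdd k (Fin.castSucc i))) (q i) / (∏ j, (∑ i, ((L j).1 i : ℝ) * z (Fin.castAdd k (Fin.castSucc i)) + ((L j).2 : ℝ)) ^ e j) * ((z (Fin.castAdd k (Fin.last b)) - (∑ i, (ℓ.1 i : ℝ) * z (Fin.castAdd k (Fin.castSucc i)) + (ℓ.2 : ℝ))) ^ i / (z (Fin.castAdd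 k (Fin.last b)) - (∑ i, (ℓ.1 i : ℝ) * z (Fin.castAdd k (Fin.castSucc i)) + (ℓ.2 : ℝ))) ^ n) * ∏ i, (a i).elim 1 (fun c => 1 / (z (Fin.natAdd (b + 1) i) - (∑ i', (c.1 i' : ℝ) * z (Fin.castAdd k i') + (c.2 : ℝ))))) s.domain := by
  intro i hiN
  classical
  have _hp := hpole
  have _hb := hb
  -- the vanishing case: a piece that is identically zero
  have hzero_case : (∀ z : Fin (b + 1 + k) → ℝ,
      MvPolynomial.aeval (fun i => z (Fin.castAdd k (Fin.castSucc i))) (q i) /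
        (∏ j, (∑ i, ((L j).1 i : ℝ) * z (Fin.castAdd k (Fin.castSucc i)) + ((L j).2 : ℝ)) ^ e j) = 0) →
      IntegrableOn (fun z : Fin (b + 1 + k) → ℝ =>
        MvPolynomial.aeval (fun i => z (Fin.castAdd k (Fin.castSucc i))) (q i) /
        (∏ j, (∑ i, ((L j).1 i : ℝ) * z (Fin.castAdd k (Fin.castSucc i)) + ((L j).2 : ℝ)) ^ e j) *
        ((z (Fin.castAdd k (Fin.last b)) - (∑ i, (ℓ.1 i : ℝ) * z (Fin.castAdd k (Fin.castSucc i)) + (ℓ.2 : ℝ))) ^ i /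
          (z (Fin.castAdd k (Fin.last b)) - (∑ i, (ℓ.1 i : ℝ) * z (Fin.castAdd k (Fin.castSucc i)) + (ℓ.2 : ℝ))) ^ n) *
        ∏ i, (a i).elim 1 (fun c => 1 / (z (Fin.natAdd (b + 1) i) -
          (∑ i', (c.1 i' : ℝ) * z (Fin.castAdd k i') + (c.2 : ℝ))))) s.domain := by
    intro h0
    have hf0 : (fun z : Fin (b + 1 + k) → ℝ =>
        MvPolynomial.aeval (fun i => z (Fin.castAdd k (Fin.castSucc i))) (q i) /
        (∏ j, (∑ i, ((L j).1 i : ℝ) * z (Fin.castAdd k (Fin.castSucc i)) + ((L j).2 : ℝ)) ^ e j) *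
        ((z (Fin.castAdd k (Fin.last b)) - (∑ i, (ℓ.1 i : ℝ) * z (Fin.castAdd k (Fin.castSucc i)) + (ℓ.2 : ℝ))) ^ i /
          (z (Fin.castAdd k (Fin.last b)) - (∑ i, (ℓ.1 i : ℝ) * z (Fin.castAdd k (Fin.castSucc i)) + (ℓ.2 : ℝ))) ^ n) *
        ∏ i, (a i).elim 1 (fun c => 1 / (z (Fin.natAdd (b + 1) i) -
          (∑ i', (c.1 i' : ℝ) * z (Fin.castAdd k i') + (c.2 : ℝ))))) = fun _ => 0 := by
      funext z; rw [h0 z, zero_mul, zero_mul]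
    rw [hf0]
    exact integrableOn_zero
  -- degenerate letters: an active letter that is identically zero kills every piece
  by_cases hdeg : ∃ j, e j ≠ 0 ∧ (L j).1 = 0 ∧ (L j).2 = 0
  · obtain ⟨j, hej, h1, h2⟩ := hdeg
    refine hzero_case fun z => ?_
    rw [Finset.prod_eq_zero (Finset.mem_univ j) (by rw [h1, h2]; simp [hej]), div_zero]
  push Not at hdeg
  -- the real data
  set κ : Fin m → Fin b → ℝ := fun j i => ((L j).1 i : ℝ) with hκ
  set μ : Fin m → ℝ := fun j => ((L j).2 : ℝ) with hμ
  set lR : Fin b → ℝ := fun i => (ℓ.1 i : ℝ) with hlR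
  set qR : ℕ → MvPolynomial (Fin b) ℝ := fun i => MvPolynomial.map (algebraMap ℚ ℝ) (q i) with hqR
  have hκ0 : ∀ j, e j ≠ 0 → κ j = 0 → μ j ≠ 0 := by
    intro j hej hk0 hμ0
    have hμ0' : ((L j).2 : ℝ) = 0 := hμ0
    refine hdeg j hej ?_ (by exact_mod_cast hμ0')
    funext i'
    have h : ((L j).1 i' : ℝ) = 0 := congr_fun hk0 i'
    rw [Pi.zero_apply]
    exact_mod_cast h
  -- the base sets: the literal base and the effective base
  set Y₀ : Set (Fin (b + 1) → ℝ) := {x | ∀ j, 0 < av x (M j)} with hY₀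
  have hdom₀ : s.domain = fdom Y₀ lo hi := hdom
  obtain ⟨m'', φ, hφ⟩ := SepHHK.exists_eff_forms M lo hi
  set Y : Set (Fin (b + 1) → ℝ) := {x | ∀ j, 0 < SepAll.rav x (φ j)} with hY
  have hYeq : Y₀ ∩ {x | (cell lo hi (av x)).Nonempty} = Y := by
    ext x; exact hφ x
  have hdom' : s.domain = fdom Y lo hi := by rw [hdom₀, SepHHK.fdom_eq_eff, hYeq]
  have hYm : MeasurableSet Y := measurableSet_Y φ
  have hYimg : basePt '' s.domain = Y := by rw [hdom₀, SepHHK.basePt_image_fdom, hYeq]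
  -- the literal base factors in nice form
  have hqx : ∀ x : Fin (b + 1) → ℝ, MvPolynomial.aeval x p = ∑ i ∈ Finset.range N,
      MvPolynomial.aeval (fun i => x (Fin.castSucc i)) (q i) *
        (x (Fin.last b) - (∑ i, (ℓ.1 i : ℝ) * x (Fin.castSucc i) + (ℓ.2 : ℝ))) ^ i := by
    intro x
    have h := hq (Fin.append x 0)
    simpa only [Fin.append_left] using h
  set R : (Fin (b + 1) → ℝ) → ℝ := fun x => MvPolynomial.aeval x p /
    (∏ j, (∑ i, ((L j).1 i : ℝ) * x (Fin.castSucc i) + ((L j).2 : ℝ)) ^ e j) *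
    (1 / (x (Fin.last b) - (∑ i, (ℓ.1 i : ℝ) * x (Fin.castSucc i) + (ℓ.2 : ℝ))) ^ n) with hRdef
  set Ri : ℕ → (Fin (b + 1) → ℝ) → ℝ := fun i x => MvPolynomial.aeval (fun i => x (Fin.castSucc i)) (q i) /
    (∏ j, (∑ i, ((L j).1 i : ℝ) * x (Fin.castSucc i) + ((L j).2 : ℝ)) ^ e j) *
    ((x (Fin.last b) - (∑ i, (ℓ.1 i : ℝ) * x (Fin.castSucc i) + (ℓ.2 : ℝ))) ^ i /
      (x (Fin.last b) - (∑ i, (ℓ.1 i : ℝ) * x (Fin.castSucc i) + (ℓ.2 : ℝ))) ^ n) with hRidef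
  have hR' : ∀ x, R x = (∑ i ∈ Finset.range N, MvPolynomial.eval (pr x) (qR i) *
      lam lR ℓ.2 x ^ i) / common κ μ e n lR ℓ.2 x :=
    fun x => baseR_eq L e p ℓ n N q hqx x
  have hRi' : ∀ i, i < N → ∀ x, Ri i x = MvPolynomial.eval (pr x) (qR i) * lam lR ℓ.2 x ^ i /
      common κ μ e n lR ℓ.2 x := fun i _ x => baseRi_eq L e ℓ n (q i) i x
  have hRm : Measurable R := measurable_baseR L e p ℓ n
  have hRim : ∀ i, Measurable (Ri i) := fun i => measurable_baseRi L e ℓ n (q i) i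
  -- the global finiteness of the integrand over the base
  have hfinY : ∫⁻ x in Y, ENNReal.ofReal |R x| * lmass lo hi a (av x) < ∞ := by
    have hI := s.integrableOn
    rw [hdom'] at hI
    have hint' : EqOn s.integrand (fun z => R (basePt z) * rblock a z) (fdom Y lo hi) := by
      intro z hz
      rw [← hdom'] at hz
      rw [hint hz]
      rfl
    exact (integrableOn_fdom_iff hYm lo hi a _ hRm s.integrand hint' hI.aestronglyMeasurable).1 hI
  -- the wall invariant on the closure of the effective base
  have hH' : ∀ j, e j ≠ 0 → ∀ x ∈ closure Y, lval κ μ j x = 0 → n ≠ 0 ∧ lam lR ℓ.2 x = 0 := by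
    intro j hej x hx hL
    rw [← hYimg] at hx
    obtain ⟨z, hz, rfl⟩ := SepHHK.closure_image_basePt_subset hbd hx
    have h := hH j hej z hz hL
    exact ⟨h.1, sub_eq_zero.2 h.2⟩
  -- an identically vanishing numerator
  by_cases hnz : ∃ x₀ : Fin (b + 1) → ℝ, (∑ i ∈ Finset.range N, MvPolynomial.eval (pr x₀) (qR i) *
      lam lR ℓ.2 x₀ ^ i) ≠ 0
  swap
  · push Not at hnz
    have hiN' : i < N := Finset.mem_range.1 hiN
    refine hzero_case fun z => ?_
    have h0 : MvPolynomial.aeval (fun i => z (Fin.castAdd k (Fin.castSucc i))) (q i) = 0 := by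
      have h := eval_eq_zero_of_num_zero N qR lR ℓ.2 hnz i hiN' (pr (basePt z))
      rw [← aeval_eq_eval_pr] at h
      exact h
    rw [h0, zero_div]
  -- local + compact
  refine SepTwoZero.integrableOn_of_forall_nhds hbd.isCompact_closure fun z₀ hz₀ => ?_
  have hcb : Continuous (basePt : (Fin (b + 1 + k) → ℝ) → Fin (b + 1) → ℝ) :=
    continuous_pi fun i => continuous_apply _
  have hb₀ : basePt z₀ ∈ closure Y := by
    rw [← hYimg]
    exact image_closure_subset_closure_image hcb ⟨z₀, hz₀, rfl⟩
  obtain ⟨V, hVo, hVx, hVfin⟩ := local_finite φ lo hi a κ μ e n lR ℓ.2 N qR R Ri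
    hR' hRi' hfinY hκ0 hH' hnz (basePt z₀) hb₀
  refine ⟨basePt ⁻¹' V, hVo.preimage hcb, hVx, ?_⟩
  have hset : s.domain ∩ basePt ⁻¹' V = fdom (Y ∩ V) lo hi := by
    rw [hdom']
    ext z
    simp only [fdom, mem_inter_iff, mem_setOf_eq, mem_preimage]
    tauto
  rw [hset]
  refine integrableOn_of_lintegral_lt_top (hYm.inter hVo.measurableSet) lo hi a (hRim i)
    (fun z _ => rfl) ?_
  calc ∫⁻ x in Y ∩ V, ENNReal.ofReal |Ri i x| * lmass lo hi a (av x)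
      ≤ ∫⁻ x in Y ∩ V, Y.indicator (fun x => (∑ i' ∈ Finset.range N, ENNReal.ofReal |Ri i' x|) *
          lmass lo hi a (av x)) x := by
        refine setLIntegral_mono' (hYm.inter hVo.measurableSet) fun x hx => ?_
        rw [indicator_of_mem hx.1]
        exact mul_le_mul_left (Finset.single_le_sum (f := fun i' => ENNReal.ofReal |Ri i' x|)
          (fun _ _ => zero_le) hiN) _
    _ ≤ _ := lintegral_mono_set inter_subset_right
    _ < ∞ := hVfin

end Summit.KontsevichZagierPeriods.ArrangementNormalForm.JanusBands
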